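import Literature.RepresentationTheory.HeisenbergGroup.SchrodingerL2Haar
import Literature.RepresentationTheory.HeisenbergGroup.SchrodingerSystemLatticePair
import HarnessLib

/-!
# The Schrödinger representation on `L²(X, ν)` of a polarised Heisenberg group with a dual lattice pair is IRREDUCIBLE

Topic `RepresentationTheory/HeisenbergGroup`; namespace `Literature.RepresentationTheory.HeisenbergGroup.SchrodingerHaar`.
KERNEL ONLY: theorems; no definition, no named fact, no record, no `sorry`.

`SchrodingerL2Haar.lean` constructs, for a commutative ring `R`, an `R`-bilinear pairing `β : X × Y → R`, a continuous
character `ψ : R → S¹` and a right-invariant measure `ν` on the topological additive group `X`, the Schrödinger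
representation `SchrodingerHaar.rep β ψ hψ hβ ν` of `Heisenberg (polar β)` on the Hilbert space `Lp ℂ 2 ν`,
`(ρ((x, y), t) f)(u) = ψ(t + β(u, y)) f(u + x)` ([Weil1964, Chap. I n° 4 p. 149, n° 11–13]).
`SchrodingerSystemLatticePair.lean` proves the theorem of Stone, von Neumann (and Mackey) in the form of
[MoeglinVignerasWaldspurger1987, Chap. 2 I.2–I.3]: on `L²(X, μ)` (`μ` a Haar measure, `X` locally compact second
countable) the system of all translations and all modulations by the characters `u ↦ ψ(β(u, y))` has no closed invariant
subspace other than `⊥`, `⊤` as soon as `ψ(β x y)` admits ONE dual lattice pair `(B₁, B₂)` whose unit scalings `a B₁`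
shrink to `0` — the situation of every finite place (`DualLatticePairLocalField.lean`) and of the finite adèles
(`DualLatticePairFiniteAdelic.lean`, `FiniteAdeleDualLatticePair.lean`).

This file joins the two vocabularies:
* §1 `translate_eq_translate`, `modulate_eq_modulate` — the operators of `SchrodingerL2Haar` ARE the operators
  `SchrodingerLevi.translate`, `SchrodingerLevi.modulate` of `SchrodingerSystem.lean` (same `L²` class);
  `rep_inl`, `rep_inr` — `ρ((x, 0), 0)` is the translation by `x`, `ρ((0, y), 0)` the modulation by `ψ(β(·, y))`;
  `mem_of_mem_translate_modulate` — a subspace stable under translations and modulations is stable under `ρ(H)`;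
* §2 **`irreducible_of_isDualLatticePair`** — the Schrödinger representation `ρ` on `L²(X, ν)` has no closed
  invariant subspace other than `⊥` and `⊤`: "une et une seule … représentation irréductible"
  [MoeglinVignerasWaldspurger1987, Chap. 2 I.2 Théorème]; this is the hypothesis `_hρi` of the statement-exact typing
  `Prop311AsPrinted` ([GelbartRogawski1991, §3.1 p. 454 L19–21]) for the `L²` model at the finite adèles.

Nothing of the cited sources is asserted; everything is proved from Mathlib and the tree.

## References
* [MoeglinVignerasWaldspurger1987] C. Mœglin, M.-F. Vignéras, J.-L. Waldspurger, *Correspondances de Howe sur un corps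
  p-adique*, LNM 1291 (1987), Chap. 2 I.2 (Théorème), I.3, I.4 Exemple (1).
* [Weil1964] A. Weil, *Sur certains groupes d'opérateurs unitaires*, Acta Math. 111 (1964), Chap. I n° 4 p. 149, n° 11–13.
* [GelbartRogawski1991] S. Gelbart, J. Rogawski, Invent. Math. 105 (1991), §3.1 p. 454 L19–21.
-/

set_option autoImplicit false

noncomputable section

open MeasureTheory Filter Set
open scoped Topology Pointwise

namespace Literature.RepresentationTheory.HeisenbergGroup

namespace SchrodingerHaar

variable {R : Type*} [CommRing R] {X Y : Type*} [AddCommGroup X] [Module R X] [AddCommGroup Y] [Module R Y]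
  (β : X →ₗ[R] Y →ₗ[R] R) (ψ : AddChar R Circle) [TopologicalSpace R] [TopologicalSpace X]
  (hψ : Continuous (ψ : R → Circle)) (hβ : ∀ y : Y, Continuous fun u : X => β u y)

/-! ## §1 The two operator vocabularies agree -/

include hψ hβ in
/-- the continuous unimodular multiplier `u ↦ ψ(β(u, y))` as an element of `C(X, S¹)`.
[cite: MoeglinVignerasWaldspurger1987, Chap. 2 I.4 Exemple (1)] -/
theorem continuous_circle_chi (y : Y) : Continuous fun u : X => (ψ (β u y) : Circle) := hψ.comp (hβ y)

variable [MeasurableSpace X] [BorelSpace X] (ν : Measure X)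

/-- **the modulation of `SchrodingerL2Haar` is the modulation of `SchrodingerSystem`** by the multiplier
`ψ(β(·, y)) ∈ C(X, S¹)`. [cite: MoeglinVignerasWaldspurger1987, Chap. 2 I.4 Exemple (1)] -/
theorem modulate_eq_modulate (y : Y) (f : Lp ℂ 2 ν) :
    modulate β ψ hψ hβ ν y f =
      SchrodingerLevi.modulate ν (⟨fun u => ψ (β u y), continuous_circle_chi β ψ hψ hβ y⟩ : C(X, Circle)) f := by
  apply Lp.ext
  filter_upwards [modulate_coeFn β ψ hψ hβ ν y f,
    SchrodingerLevi.coeFn_modulate ν (⟨fun u => ψ (β u y), continuous_circle_chi β ψ hψ hβ y⟩ : C(X, Circle)) f]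
    with u h1 h2
  rw [h1, h2, chi_apply]
  rfl

section Vocabulary

variable [IsTopologicalAddGroup X] [ν.IsAddLeftInvariant]

/-- **the translation of `SchrodingerL2Haar` is the translation of `SchrodingerSystem`** (both are Mathlib's
`Lp.compMeasurePreserving (· + x)`). [cite: MoeglinVignerasWaldspurger1987, Chap. 2 I.4 Exemple (1)] -/
theorem translate_eq_translate (x : X) (f : Lp ℂ 2 ν) : translate ν x f = SchrodingerLevi.translate ν x f :=
  Lp.ext <| (translate_coeFn ν x f).trans (SchrodingerLevi.coeFn_translate ν x f).symm

/-- `ρ((x, 0), 0) f` is the translate `f(· + x)`. [cite: Weil1964, Chap. I n° 4 p. 149] -/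
theorem rep_inl (x : X) (f : Lp ℂ 2 ν) : rep β ψ hψ hβ ν ⟨(x, 0), 0⟩ f = translate ν x f := by
  rw [rep_mk_zero, modulate_zero]

/-- `ρ((0, y), 0) f` is the modulation `ψ(β(·, y)) f`. [cite: Weil1964, Chap. I n° 4 p. 149] -/
theorem rep_inr (y : Y) (f : Lp ℂ 2 ν) : rep β ψ hψ hβ ν ⟨(0, y), 0⟩ f = modulate β ψ hψ hβ ν y f := by
  rw [rep_mk_zero, translate_zero]

/-- a subspace stable under all translations and all modulations `ψ(β(·, y))` is stable under every `ρ(h)`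
(`ρ((x, y), t) = ψ(t) • M_y ∘ τ_x`). [cite: Weil1964, Chap. I n° 4 p. 149] -/
theorem mem_of_mem_translate_modulate (K : Submodule ℂ (Lp ℂ 2 ν))
    (hKτ : ∀ (x : X), ∀ f ∈ K, translate ν x f ∈ K) (hKM : ∀ (y : Y), ∀ f ∈ K, modulate β ψ hψ hβ ν y f ∈ K)
    (h : Heisenberg (polar β)) {f : Lp ℂ 2 ν} (hf : f ∈ K) : rep β ψ hψ hβ ν h f ∈ K := by
  rw [rep_apply]
  exact K.smul_mem _ (hKM _ _ (hKτ _ _ hf))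

/-- conversely a `ρ(H)`-stable subspace is stable under translations and modulations.
[cite: Weil1964, Chap. I n° 4 p. 149] -/
theorem translate_mem_and_modulate_mem (K : Submodule ℂ (Lp ℂ 2 ν))
    (hK : ∀ (h : Heisenberg (polar β)), ∀ f ∈ K, rep β ψ hψ hβ ν h f ∈ K) :
    (∀ (x : X), ∀ f ∈ K, translate ν x f ∈ K) ∧ ∀ (y : Y), ∀ f ∈ K, modulate β ψ hψ hβ ν y f ∈ K :=
  ⟨fun x f hf => by rw [← rep_inl β ψ hψ hβ ν]; exact hK _ f hf,
    fun y f hf => by rw [← rep_inr β ψ hψ hβ ν]; exact hK _ f hf⟩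

end Vocabulary

/-! ## §2 Irreducibility from one dual lattice pair -/

section Irreducible

variable [IsTopologicalAddGroup X] [ContinuousConstSMul R X] [LocallyCompactSpace X] [SecondCountableTopology X]
  [ν.IsAddHaarMeasure]
  [TopologicalSpace Y] [ContinuousConstSMul R Y] [TopologicalSpace.SeparableSpace Y]

/-- **Irreducibility of the Schrödinger representation on `L²(X, ν)` (Stone–von Neumann–Mackey).**  `X` locally
compact second countable with Haar measure `ν`, `Y` separable, `β` separately continuous, `ψ` continuous, and
`(B₁, B₂)` a dual lattice pair for `ψ(β x y)` (`IsDualLatticePair`) whose unit scalings `a B₁` shrink to `0` in `X`.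
Then a closed subspace of `L²(X, ν)` invariant under `ρ = SchrodingerHaar.rep β ψ hψ hβ ν` is `⊥` or `⊤`: the
irreducibility `_hρi` of [GelbartRogawski1991, §3.1 p. 454 L19–21]'s "irreducible unitary representation `ρ_ψ` … with
central character `ψ`" for the `L²` model at every finite place and at the finite adèles.
[cite: MoeglinVignerasWaldspurger1987, Chap. 2 I.2 Théorème (Stone, Von Neumann), I.3] -/
theorem irreducible_of_isDualLatticePair (hβ' : ∀ x : X, Continuous fun y : Y => β x y)
    {B₁ : AddSubgroup X} {B₂ : AddSubgroup Y} (hB : IsDualLatticePair β ψ B₁ B₂)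
    (hX : ∀ N ∈ 𝓝 (0 : X), ∃ a : Rˣ, (((a : R) • B₁ : AddSubgroup X) : Set X) ⊆ N)
    (K : Submodule ℂ (Lp ℂ 2 ν)) (hKc : IsClosed (K : Set (Lp ℂ 2 ν)))
    (hK : ∀ (h : Heisenberg (polar β)), ∀ f ∈ K, rep β ψ hψ hβ ν h f ∈ K) : K = ⊥ ∨ K = ⊤ := by
  obtain ⟨hKτ, hKM⟩ := translate_mem_and_modulate_mem β ψ hψ hβ ν K hK
  refine schrodingerSystem_irreducible_of_isDualLatticePair ν β ψ (fun y => continuous_circle_chi β ψ hψ hβ y)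
    (fun x => hψ.comp (hβ' x)) hB hX K hKc (fun x f hf => ?_) (fun y f hf => ?_)
  · rw [← translate_eq_translate ν]
    exact hKτ x f hf
  · rw [← modulate_eq_modulate β ψ hψ hβ ν]
    exact hKM y f hf

/-- the same conclusion for a subspace given stable under translations and modulations only.
[cite: MoeglinVignerasWaldspurger1987, Chap. 2 I.2 Théorème (Stone, Von Neumann), I.3] -/
theorem irreducible_of_isDualLatticePair' (hβ' : ∀ x : X, Continuous fun y : Y => β x y)
    {B₁ : AddSubgroup X} {B₂ : AddSubgroup Y} (hB : IsDualLatticePair β ψ B₁ B₂)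
    (hX : ∀ N ∈ 𝓝 (0 : X), ∃ a : Rˣ, (((a : R) • B₁ : AddSubgroup X) : Set X) ⊆ N)
    (K : Submodule ℂ (Lp ℂ 2 ν)) (hKc : IsClosed (K : Set (Lp ℂ 2 ν)))
    (hKτ : ∀ (x : X), ∀ f ∈ K, translate ν x f ∈ K) (hKM : ∀ (y : Y), ∀ f ∈ K, modulate β ψ hψ hβ ν y f ∈ K) :
    K = ⊥ ∨ K = ⊤ :=
  irreducible_of_isDualLatticePair β ψ hψ hβ ν hβ' hB hX K hKc
    (fun h _ hf => mem_of_mem_translate_modulate β ψ hψ hβ ν K hKτ hKM h hf)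

end Irreducible

end SchrodingerHaar

end Literature.RepresentationTheory.HeisenbergGroup

end
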